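import Summits.CriticalPhenomena.PercolationContinuityZ3.Theorems.PercNearOneGluingNoHeavyLowerTailAttachedChampionLevelOne
import HarnessLib

/-!
# `NoHeavyLowerTail` (stmt-CriticalPhenomena-4575) — the CONDITIONED Kozma–Nitzan Lemma 2
# (= the T-form top packing TTP at level one, for EVERY relay)

Support file (lemma factory #8 `prim-lf-8`, gen 4, batch 6; `--supports stmt-CriticalPhenomena-4575`).  No definitions, no named
facts, no sorries.  `μ = prodBernoulli w` on `Fin n`, observer `o`, relays `A`, `D_x = {x ↮ A ∖ x}` (at level `j = 1` the lightness
event `|π(x)| ≤ 1`, so `μ(D_x) = S_x`).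

Kozma–Nitzan's Lemma 2 (arXiv:2401.12397 p. 6, singleton blocks; tree `Theorems.lonelyRelay`) is the packing
`Σ_{x∈A} μ(o ↔ x | D_x) ≤ μ(o ↔ A) (≤ 1)`.  This file proves the CONDITIONED form

  `Σ_{x ∈ A} μ(o ↔ x | D_x) ≤ μ(o ↔ A | D_c)`      for EVERY relay `c ∈ A`

(denominator-free: `μ(D_c) · Σ_x μ({o↔x} ∩ D_x)/μ(D_x) ≤ μ(D_c ∩ ⋃_{a∈A} {o ↔ a})`, stated for weights with `μ(D_x) > 0` for all `x`).
Since `{o ↔ A}` is increasing and `D_c` decreasing, Harris gives `μ(o ↔ A | D_c) ≤ μ(o ↔ A)`, so this sharpens Lemma 2; it is the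
level-1 case of the T-form top packing TTP (`Theorems.noHeavyLowerTail_of_tformTopPacking`, CANDIDATES.md v6 B6-1) and at level 1 it
holds for every relay `c`, whereas from level 2 on the any-relay form is false (exact witnesses, prim-lf-8 witnesses-gen4) and only the
champion form survives the censuses.

Chain (as in `…SharpTCSOne.lean`): terminal separation `μ({o↔x} ∩ D_x) μ(Sep) ≤ μ(D_x) μ({o↔x} ∩ Sep)` for `x ≠ c` (BHK 2006 Thm 1.3),
disjointness of `{o ↔ x} ∩ Sep`, the set-BHK step `AttachedChampionLevelOne.sep_touch_negCorr` `μ(D_c) μ(U ∩ Sep) ≤ μ(D_c ∩ U) μ(Sep)`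
(`U = {o ↔ A∖c}`), the champion-free `c`-term, and `{o ↔ c} ∩ D_c`, `D_c ∩ U` disjoint inside `D_c ∩ {o ↔ A}`; the null separation event is
removed by scaling the weights.

* `CondPackingOne.condPacking_one_of_pairSep_pos` — the chain for `μ(Sep) > 0`;
* `condPacking_one` — for all weights with `μ(D_x) > 0` (`x ∈ A`).
-/

noncomputable section

namespace Summit.CriticalPhenomena.PercolationContinuityZ3.Theorems

open MeasureTheory Set Filter Topology Literature.Probability.LatticeModels Literature.Probability.Percolation
open scoped Classical BigOperators Topology

namespace CondPackingOne

open AttachedChampionLevelOne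

variable {n : ℕ}

/-- **Conditioned KN Lemma 2, non-null separation event.**  Terminal separation `hTS`, `c ∈ A` and `μ(Sep) > 0` give
`μ(D_c) · Σ_{x∈A} μ({o↔x} ∩ D_x)/μ(D_x) ≤ μ(D_c ∩ ⋃_{a∈A} {o↔a})`.
[cite: KozmaNitzan2024, Lemma 1(i) + Lemma 2 (pp. 5–6); VandenbergHaggstromKahn2005, Thm. 1.3 (p. 6) — corollary] -/
theorem condPacking_one_of_pairSep_pos
    (hTS : ∀ (n : ℕ) (w : Sym2 (Fin n) → unitInterval) (T : Finset (Fin n)) (o a : Fin n),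
      (prodBernoulli w).real (openConn o a ∩ {ω | ∀ t ∈ T, ω ∉ openConn a t}) *
        (prodBernoulli w).real ({ω | ∀ t ∈ T, ω ∉ openConn a t} ∩
            {ω | ∀ t ∈ T, ∀ t' ∈ T, t ≠ t' → ω ∉ openConn t t'}) ≤
      (prodBernoulli w).real {ω | ∀ t ∈ T, ω ∉ openConn a t} *
        (prodBernoulli w).real (openConn o a ∩ ({ω | ∀ t ∈ T, ω ∉ openConn a t} ∩
              {ω | ∀ t ∈ T, ∀ t' ∈ T, t ≠ t' → ω ∉ openConn t t'})))
    (w : Sym2 (Fin n) → unitInterval) (A : Finset (Fin n)) (o c : Fin n) (hc : c ∈ A)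
    (hM : 0 < (prodBernoulli w).real
      {ω : Set (Sym2 (Fin n)) | ∀ x ∈ A, ∀ y ∈ A, x ≠ y → ω ∉ openConn x y}) :
    (prodBernoulli w).real {ω | ∀ t ∈ A.erase c, ω ∉ openConn c t} *
        ∑ x ∈ A, (prodBernoulli w).real (openConn o x ∩ {ω | ∀ t ∈ A.erase x, ω ∉ openConn x t}) /
          (prodBernoulli w).real {ω | ∀ t ∈ A.erase x, ω ∉ openConn x t} ≤
      (prodBernoulli w).real ({ω | ∀ t ∈ A.erase c, ω ∉ openConn c t} ∩ ⋃ a ∈ A, openConn o a) := by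
  set μ := prodBernoulli w with hμ
  set Sep : Set (Set (Sym2 (Fin n))) := {ω | ∀ x ∈ A, ∀ y ∈ A, x ≠ y → ω ∉ openConn x y} with hSep
  set D : Fin n → Set (Set (Sym2 (Fin n))) := fun a => {ω | ∀ t ∈ A.erase a, ω ∉ openConn a t} with hDdef
  set U : Set (Set (Sym2 (Fin n))) := ⋃ a ∈ A.erase c, openConn o a with hU
  have hmeas : ∀ s : Set (Set (Sym2 (Fin n))), MeasurableSet s := fun _ => MeasurableSet.of_discrete
  -- `Sep ⊆ D_x`, so every `μ(D_x) > 0`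
  have hSepD : ∀ x ∈ A, Sep ⊆ D x := by
    intro x hx ω hω t ht
    obtain ⟨htx, htA⟩ := Finset.mem_erase.1 ht
    exact hω x hx t htA (Ne.symm htx)
  have hDpos : ∀ x ∈ A, 0 < μ.real (D x) := fun x hx =>
    hM.trans_le (measureReal_mono (hSepD x hx) (measure_ne_top μ _))
  have hDc : μ.real (D c) ≠ 0 := ne_of_gt (hDpos c hc)
  -- (1) terms `x ≠ c`: `μ(o↔x ∩ D_x)/μ(D_x) ≤ μ(o↔x ∩ Sep)/μ(Sep)`
  have h1 : ∀ x ∈ A.erase c, μ.real (openConn o x ∩ D x) / μ.real (D x) ≤ μ.real (openConn o x ∩ Sep) / μ.real Sep := by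
    intro x hx
    obtain ⟨-, hxA⟩ := Finset.mem_erase.1 hx
    have key := hTS n w (A.erase x) o x
    rw [singleFinger_sep_inter_pairSep_eq A hxA] at key
    rw [div_le_div_iff₀ (hDpos x hxA) hM]
    linarith [key]
  -- (2) disjointness: `Σ_{x≠c} μ(o↔x ∩ Sep) = μ(U ∩ Sep)`
  have h2 : ∑ x ∈ A.erase c, μ.real (openConn o x ∩ Sep) = μ.real (U ∩ Sep) := by
    rw [hU, Set.iUnion₂_inter]
    exact (measureReal_biUnion_finset
      (singleFinger_pairwiseDisjoint_conn_inter_pairSep A (A.erase c) o (Finset.erase_subset c A))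
      (fun a _ => hmeas _)).symm
  -- (3) set-BHK: `μ(D_c) μ(U ∩ Sep) ≤ μ(D_c ∩ U) μ(Sep)`
  have h3 : μ.real (D c) * μ.real (U ∩ Sep) ≤ μ.real (D c ∩ U) * μ.real Sep := by
    have key := sep_touch_negCorr w (A.erase c) c o
    have hSepEq : D c ∩ {ω : Set (Sym2 (Fin n)) | ∀ t ∈ A.erase c, ∀ t' ∈ A.erase c, t ≠ t' → ω ∉ openConn t t'}
        = Sep := by
      rw [hDdef, hSep]; exact singleFinger_sep_inter_pairSep_eq A hc
    have hUS : D c ∩ (U ∩ {ω : Set (Sym2 (Fin n)) | ∀ t ∈ A.erase c, ∀ t' ∈ A.erase c, t ≠ t' →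
        ω ∉ openConn t t'}) = U ∩ Sep := by
      rw [← hSepEq, ← Set.inter_assoc, Set.inter_comm (D c) U, Set.inter_assoc]
    rw [hUS, hSepEq] at key
    exact key
  -- (4) the non-champion part: `μ(D_c) · Σ_{x≠c} ≤ μ(D_c ∩ U)`
  have h4 : μ.real (D c) * ∑ x ∈ A.erase c, μ.real (openConn o x ∩ D x) / μ.real (D x) ≤ μ.real (D c ∩ U) := by
    have hs : ∑ x ∈ A.erase c, μ.real (openConn o x ∩ D x) / μ.real (D x) ≤ μ.real (U ∩ Sep) / μ.real Sep := by
      calc ∑ x ∈ A.erase c, μ.real (openConn o x ∩ D x) / μ.real (D x)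
          ≤ ∑ x ∈ A.erase c, μ.real (openConn o x ∩ Sep) / μ.real Sep := Finset.sum_le_sum h1
        _ = (∑ x ∈ A.erase c, μ.real (openConn o x ∩ Sep)) / μ.real Sep := by rw [Finset.sum_div]
        _ = μ.real (U ∩ Sep) / μ.real Sep := by rw [h2]
    have hq : μ.real (U ∩ Sep) / μ.real Sep ≤ μ.real (D c ∩ U) / μ.real (D c) := by
      rw [div_le_div_iff₀ hM (hDpos c hc)]
      linarith [h3]
    calc μ.real (D c) * ∑ x ∈ A.erase c, μ.real (openConn o x ∩ D x) / μ.real (D x)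
        ≤ μ.real (D c) * (μ.real (D c ∩ U) / μ.real (D c)) :=
          mul_le_mul_of_nonneg_left (hs.trans hq) measureReal_nonneg
      _ = μ.real (D c ∩ U) := by rw [← mul_div_assoc, mul_div_cancel_left₀ _ hDc]
  -- (5) the `c`-term and reassembly
  have h5 : μ.real (D c) * (μ.real (openConn o c ∩ D c) / μ.real (D c)) = μ.real (openConn o c ∩ D c) := by
    rw [← mul_div_assoc, mul_div_cancel_left₀ _ hDc]
  have h6 : μ.real (openConn o c ∩ D c) + μ.real (D c ∩ U) ≤ μ.real (D c ∩ ⋃ a ∈ A, openConn o a) := by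
    have hdisj : Disjoint (openConn o c ∩ D c) (D c ∩ U) := by
      refine Set.disjoint_left.2 fun ω hω hω' => ?_
      obtain ⟨hoc, hD⟩ := hω
      obtain ⟨-, hUω⟩ := hω'
      rw [hU, Set.mem_iUnion₂] at hUω
      obtain ⟨b, hb, hob⟩ := hUω
      have hoc' : (openGraph ω).Reachable o c := hoc
      have hob' : (openGraph ω).Reachable o b := hob
      exact hD b hb (hoc'.symm.trans hob')
    rw [← measureReal_union hdisj (hmeas _)]
    refine measureReal_mono ?_ (measure_ne_top μ _)
    rintro ω (⟨hoc, hD⟩ | ⟨hD, hUω⟩)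
    · exact ⟨hD, Set.mem_iUnion₂.2 ⟨c, hc, hoc⟩⟩
    · rw [hU, Set.mem_iUnion₂] at hUω
      obtain ⟨b, hb, hob⟩ := hUω
      exact ⟨hD, Set.mem_iUnion₂.2 ⟨b, Finset.mem_of_mem_erase hb, hob⟩⟩
  rw [← Finset.add_sum_erase A _ hc, mul_add, h5]
  linarith [h4, h6]

end CondPackingOne

open CondPackingOne AttachedChampionLevelOne in
/-- **THE CONDITIONED KOZMA–NITZAN LEMMA 2** (all `|A|`, every relay `c`, unconditional up to non-degeneracy): for bond percolation with
arbitrary edge probabilities on `Fin n`, an observer `o`, relays `A` with `μ(a ↮ A∖a) > 0` for every `a ∈ A`, and ANY `c ∈ A`,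
  `μ(c ↮ A∖c) · Σ_{x ∈ A} μ(o ↔ x, x ↮ A∖x) / μ(x ↮ A∖x) ≤ μ(c ↮ A∖c, o ↔ A)`,
i.e. `Σ_x μ(o ↔ x | x isolated from the other relays) ≤ μ(o ↔ A | c isolated from the other relays)` — Kozma–Nitzan's packing
`Σ_x μ(o ↔ x | D_x) ≤ μ(o ↔ A)` with the right-hand side conditioned on the isolation of an arbitrary relay (smaller, by Harris).
Level one of the T-form top packing TTP, valid for every relay; from level two on only the champion form survives.
[cite: KozmaNitzan2024, Lemma 2 (p. 6); VandenbergHaggstromKahn2005, Thm. 1.3 (p. 6) — corollary] -/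
theorem condPacking_one (n : ℕ) (w : Sym2 (Fin n) → unitInterval) (A : Finset (Fin n)) (o c : Fin n) (hc : c ∈ A)
    (hpos : ∀ x ∈ A, 0 < (prodBernoulli w).real {ω | ∀ t ∈ A.erase x, ω ∉ openConn x t}) :
    (prodBernoulli w).real {ω | ∀ t ∈ A.erase c, ω ∉ openConn c t} *
        ∑ x ∈ A, (prodBernoulli w).real (openConn o x ∩ {ω | ∀ t ∈ A.erase x, ω ∉ openConn x t}) /
          (prodBernoulli w).real {ω | ∀ t ∈ A.erase x, ω ∉ openConn x t} ≤
      (prodBernoulli w).real ({ω | ∀ t ∈ A.erase c, ω ∉ openConn c t} ∩ ⋃ a ∈ A, openConn o a) := by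
  have hTS := stub_terminalSeparation fun n w s X F G hF hG hs =>
    BHK2006_clusterConditionalPositiveAssociation_holds (Fin n) w s X F G hF hG hs
  have hcont := stub_weightContinuity
  -- scaled weights `w_k = (1 - 1/(k+1)) • w`, all `< 1`, converging to `w`
  have hcmem : ∀ k : ℕ, ((1 : ℝ) - 1 / ((k : ℝ) + 1)) ∈ unitInterval := by
    intro k
    have hk : (0 : ℝ) < (k : ℝ) + 1 := Nat.cast_add_one_pos k
    have h1 : 1 / ((k : ℝ) + 1) ≤ 1 := by
      rw [div_le_one hk]; linarith [(Nat.cast_nonneg k : (0 : ℝ) ≤ k)]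
    have h0 : 0 ≤ 1 / ((k : ℝ) + 1) := by positivity
    exact ⟨by linarith, by linarith⟩
  set wk : ℕ → Sym2 (Fin n) → unitInterval :=
    fun k e => ⟨(1 - 1 / ((k : ℝ) + 1)) * (w e : ℝ), unitInterval.mul_mem (hcmem k) (w e).2⟩
    with hwk_def
  have hwk_lt : ∀ k e, ((wk k e : unitInterval) : ℝ) < 1 := by
    intro k e
    have hk : (0 : ℝ) < (k : ℝ) + 1 := Nat.cast_add_one_pos k
    have hc' : (1 : ℝ) - 1 / ((k : ℝ) + 1) < 1 := by
      have : 0 < 1 / ((k : ℝ) + 1) := by positivity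
      linarith
    calc ((wk k e : unitInterval) : ℝ) = (1 - 1 / ((k : ℝ) + 1)) * (w e : ℝ) := rfl
      _ ≤ (1 - 1 / ((k : ℝ) + 1)) := mul_le_of_le_one_right (hcmem k).1 (w e).2.2
      _ < 1 := hc'
  have hc_lim : Tendsto (fun k : ℕ => (1 : ℝ) - 1 / ((k : ℝ) + 1)) atTop (𝓝 1) := by
    simpa using tendsto_const_nhds.sub (tendsto_one_div_add_atTop_nhds_zero_nat (𝕜 := ℝ))
  have hwk_lim : Tendsto wk atTop (𝓝 w) := by
    refine tendsto_pi_nhds.2 fun e => ?_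
    rw [tendsto_subtype_rng]
    have h := hc_lim.mul_const (w e : ℝ)
    rw [one_mul] at h
    exact h
  have hlimE : ∀ E : Set (Set (Sym2 (Fin n))),
      Tendsto (fun k => (prodBernoulli (wk k)).real E) atTop (𝓝 ((prodBernoulli w).real E)) :=
    fun E => ((hcont n E).tendsto w).comp hwk_lim
  -- the inequality at each `k` (separation event non-null since all weights `< 1`)
  have hk : ∀ k, (prodBernoulli (wk k)).real {ω | ∀ t ∈ A.erase c, ω ∉ openConn c t} *
        ∑ x ∈ A, (prodBernoulli (wk k)).real (openConn o x ∩ {ω | ∀ t ∈ A.erase x, ω ∉ openConn x t}) /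
          (prodBernoulli (wk k)).real {ω | ∀ t ∈ A.erase x, ω ∉ openConn x t} ≤
      (prodBernoulli (wk k)).real ({ω | ∀ t ∈ A.erase c, ω ∉ openConn c t} ∩ ⋃ a ∈ A, openConn o a) :=
    fun k => condPacking_one_of_pairSep_pos hTS (wk k) A o c hc (singleFinger_pairSep_real_pos (wk k) (hwk_lt k) _)
  -- limits: every denominator tends to a POSITIVE limit
  have hlimL : Tendsto (fun k => (prodBernoulli (wk k)).real {ω | ∀ t ∈ A.erase c, ω ∉ openConn c t} *
        ∑ x ∈ A, (prodBernoulli (wk k)).real (openConn o x ∩ {ω | ∀ t ∈ A.erase x, ω ∉ openConn x t}) /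
          (prodBernoulli (wk k)).real {ω | ∀ t ∈ A.erase x, ω ∉ openConn x t}) atTop
      (𝓝 ((prodBernoulli w).real {ω | ∀ t ∈ A.erase c, ω ∉ openConn c t} *
        ∑ x ∈ A, (prodBernoulli w).real (openConn o x ∩ {ω | ∀ t ∈ A.erase x, ω ∉ openConn x t}) /
          (prodBernoulli w).real {ω | ∀ t ∈ A.erase x, ω ∉ openConn x t})) := by
    refine (hlimE _).mul (tendsto_finsetSum A fun x hx => ?_)
    exact (hlimE _).div (hlimE _) (ne_of_gt (hpos x hx))
  exact le_of_tendsto_of_tendsto' hlimL (hlimE _) hk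

end Summit.CriticalPhenomena.PercolationContinuityZ3.Theorems

end
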